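import Mathlib
import HarnessLib
import Literature.ComputerArithmetic.JeannerodRump2018.Theorem32
import Literature.ComputerArithmetic.GraillatLefevreMuller2015.IntegerPowers

/-!
# Goldberg, *What every computer scientist should know about floating-point arithmetic* —
# "Exactly Rounded Operations", Theorem 7 (Kahan): `(m ⊘ n) ⊗ n = m` for `n = 2^i + 2^j`

David Goldberg, *What every computer scientist should know about floating-point arithmetic*,
ACM Computing Surveys 23 (1991) 5–48, section "Rounding Error — Exactly Rounded Operations",
Theorem 7 and its proof (pp. 168–169 of the edited reprint held as
`paper:galaxy-pdf-2700773380833947720`; the theorem is invoked again on reprint p. 196: "In the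
IEEE model, we can prove that `(3.0/10.0)*10.0` evaluates to `3` (Theorem 7)"). [cite: Goldberg1991]

Typed for the engines group (unit `eng-cap-1`; HONEST FRAMING: shared numerical engines serving
client cells; rigour lives in the verifiers; every published number belongs to a client cell's
ledger, not to the engines group) as part of the cap kernel lane's literature base on EXACTLY
ROUNDED binary arithmetic (the IEEE-754 semantics the lane's verifiers assume of the host's
`binary64` operations): what dividing an integer by `n` and multiplying back does. Only the printed
mathematics is formalised; no claim about any program is made in this file.

## The text being formalised (reprint pp. 168–169)

"As a final example of exact rounding, consider dividing `m` by 10. The result is a floating-point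
number that will in general not be equal to `m/10`. When `β = 2`, multiplying `m/10` by 10 will
miraculously restore `m`, provided exact rounding is being used. Actually, a more general fact
(due to Kahan) is true. […]

**Theorem 7.** When `β = 2`, if `m` and `n` are integers with `|m| < 2^(p-1)` and `n` has the
special form `n = 2^i + 2^j`, then `(m ⊘ n) ⊗ n = m`, provided floating-point operations are
exactly rounded.

*Proof.* Scaling by a power of two is harmless, since it changes only the exponent, not the
significand. If `q = m/n`, then scale `n` so that `2^(p-1) ≤ n < 2^p` and scale `m` so that
`1/2 < q < 1`. Thus, `2^(p-2) < m < 2^p`. Since `m` has `p` significant bits, it has at most one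
bit to the right of the binary point. Changing the sign of `m` is harmless, so assume that `q > 0`.
If `q̄ = m ⊘ n`, to prove the theorem requires showing that `|n q̄ − m| ≤ 1/4` (9). That is
because `m` has at most 1 bit right of the binary point, so `n q̄` will round to `m`. To deal with
the halfway case when `|n q̄ − m| = 1/4`, note that since the initial unscaled `m` had
`|m| < 2^(p-1)`, its low-order bit was `0`, so the low-order bit of the scaled `m` is also `0`.
Thus, halfway cases will round to `m`.
Suppose that `q = .q₁q₂…`, and let `q̂ = .q₁q₂…q_p1`. To estimate `|n q̄ − m|`, first compute
`|q̂ − q| = |N/2^(p+1) − m/n|`, where `N` is an odd integer. Since `n = 2^i + 2^j` and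
`2^(p-1) ≤ n < 2^p`, it must be that `n = 2^(p-1) + 2^k` for some `k ≤ p − 2`, and thus
`|q̂ − q| = |(2^(p-1-k) + 1)N − 2^(p+1-k) m| / (n 2^(p+1-k))`. The numerator is an integer, and
since `N` is odd, it is in fact an odd integer. Thus, `|q̂ − q| ≥ 1/(n 2^(p+1-k))`. Assume `q < q̂`
(the case `q > q̂` is similar). Then `n q̄ < m`, and
`|m − n q̄| = m − n q̄ = n(q − q̄) = n(q − (q̂ − 2^(-p-1))) ≤ n(2^(-p-1) − 1/(n 2^(p+1-k)))
= (2^(p-1) + 2^k) 2^(-p-1) − 2^(-p-1+k) = 1/4`. This establishes (9) and proves the theorem. ∎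
The theorem holds true for any base `β`, as long as `2^i + 2^j` is replaced by `β^i + β^j`."

## Model and reading

Radix 2, precision `p ≥ 2`, UNBOUNDED exponent range, over `ℚ` — the float set `IsFloatU p`
(`x = M·2^e`, `|M| < 2^p`) and "exactly rounded" = a round-to-nearest map `IsRoundNearestU p fl`
(ANY tie-breaking rule) of `Literature.ComputerArithmetic.JeannerodRump2018.Summation` (helpers
`isFloatU_int`, `isFloatU_zpow`, `isFloatU_int_mul_zpow`, `exists_int_mul_of_lt` from
`JeannerodRump2018.Theorem32`, `isFloatU_mul_two_zpow` from `GraillatLefevreMuller2015.IntegerPowers`). This is Goldberg's setting for Theorem 7 (integers `m`, `n`; no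
overflow or underflow in play). The division may use any tie rule; the multiplication must break
ties to EVEN — the predicate `IsRoundNearestEvenU` below ("whenever another float is exactly as
near, the chosen one has an even NORMALISED significand"), which is what the printed halfway
argument uses. That the even rule is genuinely needed, and that both hypotheses of the theorem are
needed, is DECIDED below on explicit `p = 4` values (`tie_example`, `thirteen_fails`,
`large_m_fails`).

NEAREST IN-TREE NOTIONS (R-407(b4) dedup record): round-to-nearest-ties-to-even exists in the tree
(a) as the explicit FUNCTION `roundTiesEven p emin` of
`Literature.ComputerArithmetic.BoldoJeannerodMelquiondMuller2023.RoundToNearestEven` over the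
BOUNDED-exponent model `IsFloat p emin`, and (b) as the PREDICATE `TiesToEven p RN` ("in a tie,
`RN t` is a float of precision `p − 1`") of
`Literature.ComputerArithmetic.DeDinechinLauterMullerTorres2013.ZivRoundingTest` over `ℝ` with
unbounded exponents; the present file lives in the `ℚ` model of `JeannerodRump2018` (whose
round-to-nearest predicate `IsRoundNearestU` it reuses), so it states the tie clause over `ℚ`
(`IsRoundNearestEvenU`, 3 lines) and PROVES it equivalent to formulation (b)
(`evenSignificand_iff_isFloatU_pred`) rather than adding a fourth rounding model; no statement of
Theorem 7, of eq. (9), or of the `(m ⊘ 10) ⊗ 10 = m` fact exists elsewhere under `Literature/` or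
`Summits/` (queries listed in the submission record).

## What is proved (0 `sorry`, axioms `propext`, `Classical.choice`, `Quot.sound` only)

* `odd_numerator_bound` — the parity step: for odd `N`, `|N/2^(p+1) − m/n| ≥ 1/(n 2^(p+1-k))`;
* `goldberg_bound` — **eq. (9)** in normalised position (`n = 2^(p-1) + 2^k`, `k ≤ p-2`,
  `1/2 ≤ q < 1`, `q̄` ANY nearest float of `q`): `|n q̄ − m| ≤ 1/4`;
* `evenSignificand_iff_isFloatU_pred` — for `y ≠ 0`, "even normalised significand" ⟺ "float of
  precision `p − 1`": the tie clause of `IsRoundNearestEvenU` is the `ℚ`-transliteration of the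
  in-tree `DeDinechinLauterMullerTorres2013.ZivRoundingTest.TiesToEven` (typed over `ℝ`);
* `half_le_dist_of_isFloatU`, `isNearestU_of_abs_sub_le_quarter`, `not_evenSignificand_of_tie` —
  "so `n q̄` will round to `m`" and the halfway analysis (the tie partner has an ODD significand);
* `nearest_of_pos_of_lt`, `nearest_mul_roundedQuotient` — the scaling reduction: for all
  `|m| < 2^(p-1)`, `n = 2^i + 2^j` and ANY nearest `q̄` of `m/n`, `m` is a nearest float of
  `n·q̄` and every other nearest float of `n·q̄` has an odd normalised significand;
* `div_mul_eq_self` — **Theorem 7**: `fl' (n * fl (m / n)) = m` for `fl` round-to-nearest (any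
  ties) and `fl'` round-to-nearest-ties-to-even; `isNearestU_int_of_div_mul` (any tie rules: the
  exact product is within rounding of `m`); `div_ten_mul_ten_eq_self` (`n = 10 = 2^3 + 2^1`) and
  the binary64 instance `binary64_div_ten_mul_ten` (`p = 53`, `|m| < 2^52`);
* sharpness on explicit values, `p = 4`: `tie_example` (`m = 3`, `n = 5`: `3 ⊘ 5 = 5/8` under
  every nearest rounding and `5·(5/8) = 25/8` is the midpoint of the floats `3` and `13/4`, with
  `|13/4| > |3|` — round-half-away would answer `13/4`); `thirteen_fails` (`n = 13` is not
  `2^i + 2^j`, `two_pow_add_two_pow_ne_thirteen`; `(7 ⊘ 13) ⊗ 13 = 15/2 ≠ 7` under every pair of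
  nearest roundings); `large_m_fails` (`m = 13 ≥ 2^3`, `n = 3`: `(13 ⊘ 3) ⊗ 3 = 14` under
  ties-to-even, via `not_evenSignificand_thirteen`).
-/

namespace Literature.ComputerArithmetic.Goldberg1991

open Literature.ComputerArithmetic.JeannerodRump2018

variable {p : ℕ}

/-- `x` is *a* nearest point of the precision-`p` floats (unbounded exponents) to `t`: `x ∈ F` and
no float is strictly closer (no tie-breaking rule fixed). For a round-to-nearest map `fl`,
`fl t` is such a point (`isNearestU_apply`).
[cite: Goldberg1991, §"Exactly Rounded Operations" (reprint p. 167) "exactly rounded"] -/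
def IsNearestU (p : ℕ) (t x : ℚ) : Prop :=
  IsFloatU p x ∧ ∀ f : ℚ, IsFloatU p f → |t - x| ≤ |t - f|

/-- `x` has a normalised representation `x = M·2^e`, `2^(p-1) ≤ |M| < 2^p`, with EVEN integral
significand `M` ("its low-order bit was 0").
[cite: Goldberg1991, Theorem 7, proof (reprint p. 169)] -/
def EvenSignificand (p : ℕ) (x : ℚ) : Prop :=
  ∃ M e : ℤ, (2 : ℤ) ^ (p - 1) ≤ |M| ∧ |M| < 2 ^ p ∧ Even M ∧ x = (M : ℚ) * (2 : ℚ) ^ e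

/-- Round-to-nearest, ties-to-EVEN, into the unbounded-exponent floats: `fl` is a round-to-nearest
map and, whenever some other float is exactly as near to `t` as `fl t`, the chosen `fl t` has an
even normalised significand (IEEE 754's default "exactly rounded" operations).
[cite: Goldberg1991, §"The IEEE Standard"/"Exactly Rounded Operations" (reprint pp. 166–169)] -/
def IsRoundNearestEvenU (p : ℕ) (fl : ℚ → ℚ) : Prop :=
  IsRoundNearestU p fl ∧
    ∀ t f : ℚ, IsFloatU p f → f ≠ fl t → |t - f| = |t - fl t| → EvenSignificand p (fl t)

/-- A round-to-nearest map returns a nearest float.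
[cite: Goldberg1991, §"Exactly Rounded Operations" (reprint p. 167)] -/
theorem isNearestU_apply {fl : ℚ → ℚ} (hfl : IsRoundNearestU p fl) (t : ℚ) :
    IsNearestU p t (fl t) := hfl t

/-! ### Symmetries of the model: negation and scaling by powers of two -/

/-- Nearest points are preserved by negation.
[cite: Goldberg1991, Theorem 7, proof (reprint p. 169) "Changing the sign of m is harmless"] -/
theorem IsNearestU.neg {t x : ℚ} (h : IsNearestU p t x) : IsNearestU p (-t) (-x) := by
  refine ⟨IsFloatU.neg h.1, fun f hf => ?_⟩
  have := h.2 (-f) (IsFloatU.neg hf)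
  rw [show -t - -x = -(t - x) by ring, abs_neg, show -t - f = -(t - -f) by ring, abs_neg]
  exact this

/-- Nearest points are preserved by scaling by a power of two.
[cite: Goldberg1991, Theorem 7, proof (reprint p. 169) "Scaling by a power of two is harmless"] -/
theorem IsNearestU.mul_two_zpow {t x : ℚ} (h : IsNearestU p t x) (s : ℤ) :
    IsNearestU p (t * (2 : ℚ) ^ s) (x * (2 : ℚ) ^ s) := by
  refine ⟨GraillatLefevreMuller2015.isFloatU_mul_two_zpow h.1 s, fun f hf => ?_⟩
  have h2 : (0 : ℚ) < (2 : ℚ) ^ s := zpow_pos (by norm_num) s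
  have key := h.2 (f * (2 : ℚ) ^ (-s)) (GraillatLefevreMuller2015.isFloatU_mul_two_zpow hf (-s))
  have e1 : t * 2 ^ s - x * 2 ^ s = (t - x) * 2 ^ s := by ring
  have e2 : t * (2 : ℚ) ^ s - f = (t - f * 2 ^ (-s)) * 2 ^ s := by
    rw [sub_mul, mul_assoc, ← zpow_add₀ (by norm_num : (2 : ℚ) ≠ 0)]; simp
  rw [e1, e2, abs_mul, abs_mul, abs_of_pos h2]
  exact mul_le_mul_of_nonneg_right key h2.le

/-- Even significands are preserved by negation.
[cite: Goldberg1991, Theorem 7, proof (reprint p. 169) "Changing the sign of m is harmless"] -/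
theorem EvenSignificand.neg {x : ℚ} (h : EvenSignificand p x) : EvenSignificand p (-x) := by
  obtain ⟨M, e, h1, h2, h3, rfl⟩ := h
  exact ⟨-M, e, by simpa using h1, by simpa using h2, by simpa using h3, by push_cast; ring⟩

/-- Even significands are preserved by scaling by a power of two ("it changes only the exponent,
not the significand"). [cite: Goldberg1991, Theorem 7, proof (reprint p. 169) "Scaling by a power of two is harmless"] -/
theorem EvenSignificand.mul_two_zpow {x : ℚ} (h : EvenSignificand p x) (s : ℤ) :
    EvenSignificand p (x * (2 : ℚ) ^ s) := by
  obtain ⟨M, e, h1, h2, h3, rfl⟩ := h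
  exact ⟨M, e + s, h1, h2, h3, by rw [zpow_add₀ (by norm_num : (2 : ℚ) ≠ 0)]; ring⟩

/-- `iff` form of `EvenSignificand.neg`. [cite: Goldberg1991, Theorem 7, proof (reprint p. 169) "Changing the sign of m is harmless"] -/
theorem evenSignificand_neg_iff {x : ℚ} : EvenSignificand p (-x) ↔ EvenSignificand p x :=
  ⟨fun h => by simpa using h.neg, fun h => h.neg⟩

/-- `iff` form of `EvenSignificand.mul_two_zpow`. [cite: Goldberg1991, Theorem 7, proof (reprint p. 169) "Scaling by a power of two is harmless"] -/
theorem evenSignificand_mul_two_zpow_iff {x : ℚ} (s : ℤ) :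
    EvenSignificand p (x * (2 : ℚ) ^ s) ↔ EvenSignificand p x := by
  refine ⟨fun h => ?_, fun h => h.mul_two_zpow s⟩
  have := h.mul_two_zpow (-s)
  rwa [mul_assoc, ← zpow_add₀ (by norm_num : (2 : ℚ) ≠ 0), add_neg_cancel, zpow_zero,
    mul_one] at this

/-- Normalisation: a nonzero integer below `2^n`, shifted left by some `k ≥ 1` places, lands in
`[2^n, 2^(n+1))`. [folklore] -/
private theorem exists_shift_normalise (n : ℕ) : ∀ N : ℤ, N ≠ 0 → |N| < 2 ^ n →
    ∃ k : ℕ, 1 ≤ k ∧ (2 : ℤ) ^ n ≤ |N| * 2 ^ k ∧ |N| * 2 ^ k < 2 ^ (n + 1) := by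
  induction n with
  | zero =>
    intro N hN h
    have := Int.one_le_abs hN
    simp at h
    omega
  | succ n ih =>
    intro N hN h
    rcases le_or_gt ((2 : ℤ) ^ n) |N| with hle | hlt
    · refine ⟨1, le_rfl, ?_, ?_⟩
      · rw [pow_succ, pow_one]; linarith [abs_nonneg N]
      · rw [pow_one, pow_succ (2 : ℤ) (n + 1), pow_succ (2 : ℤ) n]
        rw [pow_succ] at h
        linarith [abs_nonneg N]
    · obtain ⟨k, hk1, hlo, hhi⟩ := ih N hN hlt
      refine ⟨k + 1, by omega, ?_, ?_⟩
      · rw [pow_succ, pow_succ, ← mul_assoc]; linarith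
      · rw [pow_succ, ← mul_assoc, pow_succ (2 : ℤ) (n + 1)]; linarith

/-- For `y ≠ 0`, "even normalised significand in precision `p`" is the same as "a float of
precision `p - 1`" — the form in which the ties-to-even rule is typed (over `ℝ`) as
`Literature.ComputerArithmetic.DeDinechinLauterMullerTorres2013.ZivRoundingTest.TiesToEven`; so the
tie clause of `IsRoundNearestEvenU` is the `ℚ`-transliteration of that in-tree predicate (a value
`fl t = 0` is never in a tie: `t = 0` has the unique nearest float `0`).
[cite: Goldberg1991, Theorem 7, proof (reprint p. 169) "its low-order bit was 0"] -/
theorem evenSignificand_iff_isFloatU_pred (hp : 2 ≤ p) {y : ℚ} (hy : y ≠ 0) :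
    EvenSignificand p y ↔ IsFloatU (p - 1) y := by
  obtain ⟨n, rfl⟩ : ∃ n, p = n + 1 := ⟨p - 1, by omega⟩
  simp only [Nat.add_sub_cancel]
  constructor
  · rintro ⟨M, e, hM1, hM2, ⟨r, hr⟩, hy'⟩
    have hMr : |M| = 2 * |r| := by
      rw [hr, ← two_mul, abs_mul, abs_of_pos (by norm_num : (0 : ℤ) < 2)]
    rw [pow_succ] at hM2
    refine ⟨r, e + 1, by linarith, ?_⟩
    rw [hy', hr, zpow_add_one₀ (by norm_num : (2 : ℚ) ≠ 0)]; push_cast; ring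
  · rintro ⟨N, e, hN, hy'⟩
    have hN0 : N ≠ 0 := by
      rintro rfl
      simp at hy'
      exact hy hy'
    obtain ⟨k, hk1, hlo, hhi⟩ := exists_shift_normalise n N hN0 hN
    obtain ⟨k', rfl⟩ : ∃ k', k = k' + 1 := ⟨k - 1, by omega⟩
    refine ⟨N * 2 ^ (k' + 1), e - (k' + 1 : ℕ), ?_, ?_, ⟨N * 2 ^ k', by rw [pow_succ]; ring⟩, ?_⟩
    · rwa [abs_mul, abs_pow, abs_of_pos (by norm_num : (0 : ℤ) < 2)]
    · rwa [abs_mul, abs_pow, abs_of_pos (by norm_num : (0 : ℤ) < 2)]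
    · rw [hy', zpow_sub₀ (by norm_num : (2 : ℚ) ≠ 0), zpow_natCast]
      have h2k : (2 : ℚ) ^ (k' + 1) ≠ 0 := pow_ne_zero _ (by norm_num)
      push_cast
      rw [mul_div_assoc', eq_div_iff h2k, mul_assoc, mul_assoc, mul_comm ((2 : ℚ) ^ (k' + 1))]

/-- A nearest point of a float is the float itself.
[cite: Goldberg1991, §"Exactly Rounded Operations" (reprint p. 167)] -/
theorem IsNearestU.eq_of_isFloatU {t x : ℚ} (h : IsNearestU p t x) (ht : IsFloatU p t) : x = t := by
  have := h.2 t ht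
  rw [sub_self, abs_zero] at this
  have : |t - x| = 0 := le_antisymm this (abs_nonneg _)
  rw [abs_eq_zero, sub_eq_zero] at this
  exact this.symm

/-! ### The normalised core of the printed proof -/

/-- The parity step of the proof of Theorem 7: with `n = 2^(p-1) + 2^k` (`k = p-1-K ≤ p-2`) and an
integer `m`, every odd `N` satisfies `|N/2^(p+1) − m/n| ≥ 1/(n·2^(p+1-k))`, because
`n·2^(p+1-k)·(N/2^(p+1) − m/n) = (2^(p-1-k) + 1)·N − 2^(p+1-k)·m` "is an odd integer".
[cite: Goldberg1991, Theorem 7, proof (reprint p. 169)] -/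
theorem odd_numerator_bound (hp : 2 ≤ p) {K : ℕ} (hK : 1 ≤ K) (m : ℤ) {N : ℤ} (hN : Odd N) :
    1 / (2 ^ (K + 2) * ((2 : ℚ) ^ (p - 1) + 2 ^ (p - 1) / 2 ^ K)) ≤
      |(N : ℚ) / 2 ^ (p + 1) - m / ((2 : ℚ) ^ (p - 1) + 2 ^ (p - 1) / 2 ^ K)| := by
  set n : ℚ := (2 : ℚ) ^ (p - 1) + 2 ^ (p - 1) / 2 ^ K with hn
  have hn0 : 0 < n := by positivity
  have hD : 0 < 2 ^ (K + 2) * n := by positivity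
  -- the odd integer
  set Z : ℤ := (2 ^ K + 1) * N - 2 ^ (K + 2) * m with hZ
  have hZodd : Odd Z := by
    have h1 : Odd ((2 : ℤ) ^ K + 1) := by
      refine Even.add_odd ?_ odd_one
      exact (Int.even_pow' (by omega)).mpr (by decide)
    have h2 : Even ((2 : ℤ) ^ (K + 2) * m) :=
      ((Int.even_pow' (by omega)).mpr (by decide)).mul_right m
    rw [hZ]; exact (h1.mul hN).sub_even h2
  have hZ1 : (1 : ℚ) ≤ |(Z : ℚ)| := by
    have : Z ≠ 0 := fun h => by rw [h] at hZodd; have := Int.odd_iff.mp hZodd; omega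
    exact_mod_cast Int.one_le_abs this
  have hp2 : (2 : ℚ) ^ (p + 1) = 2 ^ (p - 1) * 4 := by
    rw [show p + 1 = (p - 1) + 2 by omega, pow_add]; norm_num
  have hid : ((N : ℚ) / 2 ^ (p + 1) - m / n) * (2 ^ (K + 2) * n) = Z := by
    rw [hZ, hn]; push_cast
    field_simp
    rw [hp2]; ring
  rw [div_le_iff₀ hD, ← abs_of_pos hD, ← abs_mul, hid]
  exact hZ1

/-- **Eq. (9)** of the printed proof, in normalised position: `n = 2^(p-1) + 2^k` with `k ≤ p-2`
(written `2^(p-1) + 2^(p-1)/2^K`, `K ≥ 1`), `m` an integer with `1/2 ≤ q = m/n < 1`, and `q̄`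
ANY nearest float of `q`; then `|n·q̄ − m| ≤ 1/4`.
[cite: Goldberg1991, Theorem 7, proof, eq. (9) (reprint pp. 168–169)] -/
theorem goldberg_bound (hp : 2 ≤ p) {K : ℕ} (hK : 1 ≤ K) {m : ℤ}
    (hlo : (2 : ℚ) ^ (p - 1) + 2 ^ (p - 1) / 2 ^ K ≤ 2 * m)
    (hhi : (m : ℚ) < (2 : ℚ) ^ (p - 1) + 2 ^ (p - 1) / 2 ^ K) {qb : ℚ}
    (hq : IsNearestU p ((m : ℚ) / ((2 : ℚ) ^ (p - 1) + 2 ^ (p - 1) / 2 ^ K)) qb) :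
    |((2 : ℚ) ^ (p - 1) + 2 ^ (p - 1) / 2 ^ K) * qb - m| ≤ 1 / 4 := by
  set n : ℚ := (2 : ℚ) ^ (p - 1) + 2 ^ (p - 1) / 2 ^ K with hn
  have hp1 : 1 ≤ p := by omega
  have hn0 : 0 < n := by positivity
  set q : ℚ := (m : ℚ) / n with hq_def
  have hq1 : 1 / 2 ≤ q := by
    rw [hq_def, le_div_iff₀ hn0]; linarith
  have hq2 : q < 1 := by rw [hq_def, div_lt_one hn0]; exact hhi
  -- qb ∈ [1/2, 1]
  have hhalf : IsFloatU p (1 / 2 : ℚ) := by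
    have := isFloatU_zpow hp1 (-1 : ℤ); norm_num at this; exact this
  have hone : IsFloatU p (1 : ℚ) := by
    have := isFloatU_zpow hp1 (0 : ℤ); norm_num at this; exact this
  have hqb1 : 1 / 2 ≤ qb := by
    have := hq.2 _ hhalf
    rw [abs_of_nonneg (by linarith : (0 : ℚ) ≤ q - 1 / 2)] at this
    have := (abs_le.mp this).2; linarith
  have hqb2 : qb ≤ 1 := by
    have := hq.2 _ hone
    rw [abs_of_nonpos (by linarith : q - 1 ≤ 0)] at this
    have := (abs_le.mp this).1; linarith
  -- qb is on the grid 2^-p · ℤ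
  obtain ⟨G, hG⟩ : ∃ G : ℤ, qb = (G : ℚ) / 2 ^ p := by
    rcases eq_or_lt_of_le hqb1 with h | h
    · refine ⟨2 ^ (p - 1), ?_⟩
      rw [← h]; push_cast
      rw [show (2 : ℚ) ^ p = 2 ^ (p - 1) * 2 by rw [← pow_succ]; congr 1; omega]
      field_simp
    · obtain ⟨G, hG⟩ := exists_int_mul_of_lt hq.1 (k := -1) (by norm_num; linarith)
      refine ⟨G, ?_⟩
      rw [hG, show (-1 : ℤ) + 1 - p = -(p : ℤ) by ring, zpow_neg, zpow_natCast, div_eq_mul_inv]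
  -- |q - qb| ≤ 2^-(p+1): q lies between the consecutive floats F/2^p and (F+1)/2^p
  have hdist : |q - qb| ≤ 1 / 2 ^ (p + 1) := by
    have h2p : (0 : ℚ) < 2 ^ p := by positivity
    set F : ℤ := ⌊q * 2 ^ p⌋ with hF
    have hF0 : 0 ≤ F := by rw [hF]; exact Int.floor_nonneg.mpr (by positivity)
    have hFlt : (F : ℚ) < 2 ^ p := lt_of_le_of_lt (Int.floor_le _) (by nlinarith)
    have hFlt' : F < 2 ^ p := by exact_mod_cast hFlt
    have ha : IsFloatU p ((F : ℚ) / 2 ^ p) := by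
      have := isFloatU_int_mul_zpow (p := p) (n := F) (by rw [abs_of_nonneg hF0]; exact hFlt')
        (-(p : ℤ))
      rwa [zpow_neg, zpow_natCast, ← div_eq_mul_inv] at this
    have hb : IsFloatU p (((F : ℚ) + 1) / 2 ^ p) := by
      rcases lt_or_eq_of_le (Int.add_one_le_iff.mpr hFlt' : F + 1 ≤ 2 ^ p) with h | h
      · have := isFloatU_int_mul_zpow (p := p) (n := F + 1)
          (by rw [abs_of_nonneg (by omega)]; exact h) (-(p : ℤ))
        rw [zpow_neg, zpow_natCast, ← div_eq_mul_inv] at this; exact_mod_cast this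
      · have e : ((F : ℚ) + 1) / 2 ^ p = 1 := by
          rw [div_eq_one_iff_eq h2p.ne']; exact_mod_cast h
        rw [e]; exact hone
    have hal : (F : ℚ) / 2 ^ p ≤ q := by
      rw [div_le_iff₀ h2p]; exact Int.floor_le _
    have hbu : q ≤ ((F : ℚ) + 1) / 2 ^ p := by
      rw [le_div_iff₀ h2p]; exact (Int.lt_floor_add_one _).le
    have h1 := hq.2 _ ha
    have h2 := hq.2 _ hb
    rw [abs_of_nonneg (by linarith : 0 ≤ q - (F : ℚ) / 2 ^ p)] at h1
    rw [abs_of_nonpos (by linarith : q - ((F : ℚ) + 1) / 2 ^ p ≤ 0)] at h2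
    have hgap : ((F : ℚ) + 1) / 2 ^ p - (F : ℚ) / 2 ^ p = 2 * (1 / 2 ^ (p + 1)) := by
      rw [pow_succ]; field_simp; ring
    linarith
  -- n / 2^(p+1) = 1/4 + 1/2^(K+2)
  have hn4 : n / 2 ^ (p + 1) = 1 / 4 + 1 / (2 ^ (K + 2) * n) * n := by
    rw [hn]
    have hp2 : (2 : ℚ) ^ (p + 1) = 2 ^ (p - 1) * 4 := by
      rw [show p + 1 = (p - 1) + 2 by omega, pow_add]; norm_num
    rw [hp2]; field_simp; ring
  have hδ := fun (N : ℤ) (hN : Odd N) => odd_numerator_bound hp hK m hN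
  -- main estimate, two cases
  have hnq : n * qb - m = n * (qb - q) := by rw [hq_def]; field_simp
  rw [hnq, abs_mul, abs_of_pos hn0]
  rcases le_total q qb with hle | hle
  · -- q ≤ qb: compare with the odd point qb - 2^-(p+1) = (2G-1)/2^(p+1)
    have hodd : Odd (2 * G - 1) := by
      refine ⟨G - 1, by ring⟩
    have key := hδ _ hodd
    have ept : ((2 * G - 1 : ℤ) : ℚ) / 2 ^ (p + 1) = qb - 1 / 2 ^ (p + 1) := by
      rw [hG, pow_succ]; push_cast; field_simp
    rw [ept] at key
    have hbelow : qb - 1 / 2 ^ (p + 1) ≤ q := by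
      have := (abs_le.mp hdist).1; linarith
    rw [show qb - 1 / 2 ^ (p + 1) - (m : ℚ) / n = -(q - (qb - 1 / 2 ^ (p + 1))) by
      rw [hq_def]; ring, abs_neg, abs_of_nonneg (by linarith)] at key
    rw [abs_of_nonneg (by linarith)]
    calc n * (qb - q) ≤ n * (1 / 2 ^ (p + 1) - 1 / (2 ^ (K + 2) * n)) :=
          mul_le_mul_of_nonneg_left (by linarith) hn0.le
      _ = 1 / 4 := by rw [mul_sub, ← div_eq_mul_one_div, hn4]; ring
  · -- qb ≤ q: compare with the odd point qb + 2^-(p+1) = (2G+1)/2^(p+1)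
    have hodd : Odd (2 * G + 1) := ⟨G, rfl⟩
    have key := hδ _ hodd
    have ept : ((2 * G + 1 : ℤ) : ℚ) / 2 ^ (p + 1) = qb + 1 / 2 ^ (p + 1) := by
      rw [hG, pow_succ]; push_cast; field_simp
    rw [ept] at key
    have habove : q ≤ qb + 1 / 2 ^ (p + 1) := by
      have := (abs_le.mp hdist).2; linarith
    rw [show qb + 1 / 2 ^ (p + 1) - (m : ℚ) / n = (qb + 1 / 2 ^ (p + 1)) - q by rw [hq_def],
      abs_of_nonneg (by linarith)] at key
    rw [abs_of_nonpos (by linarith)]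
    calc n * -(qb - q) = n * (q - qb) := by ring
      _ ≤ n * (1 / 2 ^ (p + 1) - 1 / (2 ^ (K + 2) * n)) :=
          mul_le_mul_of_nonneg_left (by linarith) hn0.le
      _ = 1 / 4 := by rw [mul_sub, ← div_eq_mul_one_div, hn4]; ring


/-! ### Near an integer `m ∈ (2^(p-2), 2^p)` the floats are at least `1/2` apart -/

/-- For an integer `2^(p-2) < m < 2^p`, every other float is at distance `≥ 1/2` from `m` ("`m` has
at most one bit right of the binary point, so `n·q̄` will round to `m`").
[cite: Goldberg1991, Theorem 7, proof (reprint p. 169)] -/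
theorem half_le_dist_of_isFloatU (hp : 2 ≤ p) {m : ℤ} (hm1 : (2 : ℚ) ^ (p - 2) < m)
    {y : ℚ} (hy : IsFloatU p y) (hne : y ≠ m) : 1 / 2 ≤ |y - m| := by
  obtain ⟨M, e, hM, rfl⟩ := hy
  have hm3 : (2 : ℚ) ^ (p - 2) + 1 ≤ m := by
    have h : (2 : ℤ) ^ (p - 2) < m := by exact_mod_cast hm1
    have h' : (2 : ℤ) ^ (p - 2) + 1 ≤ m := h
    exact_mod_cast h'
  rcases le_or_gt (-1) e with he | he
  · -- `2y` is an integer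
    obtain ⟨Y, hY⟩ : ∃ Y : ℤ, (M : ℚ) * 2 ^ e * 2 = Y := by
      refine ⟨M * 2 ^ (e + 1).toNat, ?_⟩
      push_cast
      rw [← zpow_natCast, Int.toNat_of_nonneg (by omega), zpow_add₀ (by norm_num : (2 : ℚ) ≠ 0),
        zpow_one]; ring
    have hne' : Y ≠ 2 * m := by
      intro h; apply hne
      have : (M : ℚ) * 2 ^ e * 2 = 2 * m := by rw [hY]; exact_mod_cast h
      linarith
    have h1 : (1 : ℚ) ≤ |((Y : ℚ)) - 2 * m| := by
      have := Int.one_le_abs (sub_ne_zero.mpr hne')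
      exact_mod_cast this
    have e2 : (Y : ℚ) - 2 * m = 2 * ((M : ℚ) * 2 ^ e - m) := by rw [← hY]; ring
    rw [e2, abs_mul, abs_two] at h1
    linarith
  · -- `e ≤ -2`: `|y| ≤ (2^p - 1)/4 < 2^(p-2) ≤ m - 1`
    have hMq : |(M : ℚ)| ≤ 2 ^ p - 1 := by
      have : |M| ≤ 2 ^ p - 1 := by omega
      exact_mod_cast this
    have h2e : (2 : ℚ) ^ e ≤ 1 / 4 := by
      calc (2 : ℚ) ^ e ≤ 2 ^ (-2 : ℤ) := zpow_le_zpow_right₀ (by norm_num) (by omega)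
        _ = 1 / 4 := by norm_num
    have hy : |(M : ℚ) * 2 ^ e| ≤ (2 ^ p - 1) * (1 / 4) := by
      rw [abs_mul, abs_of_pos (zpow_pos (by norm_num : (0 : ℚ) < 2) e)]
      exact mul_le_mul hMq h2e (zpow_pos (by norm_num) e).le (by linarith [abs_nonneg (M : ℚ)])
    have hp4 : (2 : ℚ) ^ p = 2 ^ (p - 2) * 4 := by
      rw [show (4 : ℚ) = 2 ^ 2 by norm_num, ← pow_add, Nat.sub_add_cancel hp]
    have := (abs_le.mp hy).2
    rw [abs_sub_comm, abs_of_nonneg (by linarith)]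
    linarith

/-- `m` is a nearest float of any `t` with `|t − m| ≤ 1/4` (`m` an integer in `(2^(p-2), 2^p)`).
[cite: Goldberg1991, Theorem 7, proof (reprint p. 169) "so `n q̄` will round to `m`"] -/
theorem isNearestU_of_abs_sub_le_quarter (hp : 2 ≤ p) {m : ℤ} (hm1 : (2 : ℚ) ^ (p - 2) < m)
    (hm2 : (m : ℚ) < 2 ^ p) {t : ℚ} (ht : |t - m| ≤ 1 / 4) : IsNearestU p t m := by
  have hm0 : (0 : ℚ) ≤ m := le_trans (by positivity) hm1.le
  have hmf : IsFloatU p (m : ℚ) :=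
    isFloatU_int (by rw [abs_of_nonneg (by exact_mod_cast hm0)]; exact_mod_cast hm2)
  refine ⟨hmf, fun f hf => ?_⟩
  by_cases hfm : f = m
  · rw [hfm]
  have h1 := half_le_dist_of_isFloatU hp hm1 hf hfm
  have h2 : |f - m| ≤ |t - f| + |t - m| := by
    calc |f - m| = |(t - m) - (t - f)| := by ring_nf
      _ ≤ |t - m| + |t - f| := abs_sub _ _
      _ = |t - f| + |t - m| := add_comm _ _
  linarith

/-- The halfway analysis: a nearest float `y ≠ m` of such a `t` is `m ± 1/2` and has an ODD
normalised significand — so round-half-even returns `m` ("its low-order bit was 0, so … halfway cases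
will round to `m`").
[cite: Goldberg1991, Theorem 7, proof (reprint p. 169)] -/
theorem not_evenSignificand_of_tie (hp : 2 ≤ p) {m : ℤ} (hm1 : (2 : ℚ) ^ (p - 2) < m)
    (hm2 : (m : ℚ) < 2 ^ p) {t y : ℚ} (ht : |t - m| ≤ 1 / 4) (hy : IsNearestU p t y)
    (hne : y ≠ m) : ¬ EvenSignificand p y := by
  have hm3 : (2 : ℚ) ^ (p - 2) + 1 ≤ m := by
    have h : (2 : ℤ) ^ (p - 2) < m := by exact_mod_cast hm1
    have h' : (2 : ℤ) ^ (p - 2) + 1 ≤ m := h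
    exact_mod_cast h'
  have hnear := isNearestU_of_abs_sub_le_quarter hp hm1 hm2 ht
  have h1 : |t - y| ≤ |t - m| := hy.2 _ hnear.1
  have hym : |y - m| ≤ 1 / 2 := by
    calc |y - m| = |(t - m) - (t - y)| := by ring_nf
      _ ≤ |t - m| + |t - y| := abs_sub _ _
      _ ≤ 1 / 4 + 1 / 4 := by linarith
      _ = 1 / 2 := by norm_num
  rintro ⟨M, e, -, hM2, hMev, rfl⟩
  rcases le_or_gt (-1) e with he | he
  · -- `e ≥ -1` and `M` even (or `e ≥ 0`): `y` is an integer `≠ m`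
    obtain ⟨Y, hY⟩ : ∃ Y : ℤ, (M : ℚ) * 2 ^ e = Y := by
      obtain ⟨k, hk⟩ := hMev
      refine ⟨k * 2 ^ (e + 1).toNat, ?_⟩
      push_cast
      rw [← zpow_natCast, Int.toNat_of_nonneg (by omega), zpow_add₀ (by norm_num : (2 : ℚ) ≠ 0),
        zpow_one, hk]; push_cast; ring
    have hne' : Y ≠ m := by
      intro h; apply hne; rw [hY, h]
    have h1 : (1 : ℚ) ≤ |((Y : ℚ)) - m| := by
      have := Int.one_le_abs (sub_ne_zero.mpr hne')
      exact_mod_cast this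
    rw [hY] at hym
    linarith
  · -- `e ≤ -2`: `|y| < 2^(p-2) ≤ m - 1`
    have hMq : |(M : ℚ)| ≤ 2 ^ p - 1 := by
      have : |M| ≤ 2 ^ p - 1 := by omega
      exact_mod_cast this
    have h2e : (2 : ℚ) ^ e ≤ 1 / 4 := by
      calc (2 : ℚ) ^ e ≤ 2 ^ (-2 : ℤ) := zpow_le_zpow_right₀ (by norm_num) (by omega)
        _ = 1 / 4 := by norm_num
    have hy' : |(M : ℚ) * 2 ^ e| ≤ (2 ^ p - 1) * (1 / 4) := by
      rw [abs_mul, abs_of_pos (zpow_pos (by norm_num : (0 : ℚ) < 2) e)]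
      exact mul_le_mul hMq h2e (zpow_pos (by norm_num) e).le (by linarith [abs_nonneg (M : ℚ)])
    have hp4 : (2 : ℚ) ^ p = 2 ^ (p - 2) * 4 := by
      rw [show (4 : ℚ) = 2 ^ 2 by norm_num, ← pow_add, Nat.sub_add_cancel hp]
    have := (abs_le.mp hy').2
    have := (abs_le.mp hym).1
    linarith

/-! ### Theorem 7 -/

/-- Theorem 7 for `0 < m < 2^(p-1)` and `n = 2^i + 2^j` with `j < i`, in "nearest point" form:
for ANY nearest float `q̄` of `m/n`, (a) `m` is a nearest float of `n·q̄`, and (b) any other nearest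
float of `n·q̄` has an odd normalised significand. (The printed proof: scale `n` by `2^(p-1-i)` to
`2^(p-1) ≤ n < 2^p` and `q` into `[1/2, 1)`, then eq. (9).)
[cite: Goldberg1991, Theorem 7 + proof (reprint pp. 168–169)] -/
theorem nearest_of_pos_of_lt (hp : 2 ≤ p) {m : ℤ} (hm0 : 0 < m) (hm : (m : ℚ) < 2 ^ (p - 1))
    {i j : ℕ} (hji : j < i) {qb : ℚ} (hq : IsNearestU p ((m : ℚ) / (2 ^ i + 2 ^ j)) qb) :
    IsNearestU p ((2 ^ i + 2 ^ j : ℚ) * qb) m ∧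
      ∀ y : ℚ, IsNearestU p ((2 ^ i + 2 ^ j : ℚ) * qb) y → y ≠ m → ¬ EvenSignificand p y := by
  have hp1 : 1 ≤ p := by omega
  -- K = i - j ≥ 1; normalised divisor Nn = n · 2^s, s = p - 1 - i
  obtain ⟨K, rfl⟩ : ∃ K, i = j + K := ⟨i - j, by omega⟩
  have hK : 1 ≤ K := by omega
  set n : ℚ := 2 ^ (j + K) + 2 ^ j with hn_def
  have hn0 : 0 < n := by positivity
  set Nn : ℚ := (2 : ℚ) ^ (p - 1) + 2 ^ (p - 1) / 2 ^ K with hNn_def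
  have hNn0 : 0 < Nn := by positivity
  set s : ℤ := (p : ℤ) - 1 - (j + K : ℕ) with hs_def
  have h2 : (2 : ℚ) ≠ 0 := by norm_num
  have hns : n * (2 : ℚ) ^ s = Nn := by
    have e1 : (2 : ℚ) ^ (j + K) * (2 : ℚ) ^ s = 2 ^ (p - 1) := by
      rw [← zpow_natCast, ← zpow_add₀ h2, hs_def]
      rw [show ((j + K : ℕ) : ℤ) + ((p : ℤ) - 1 - (j + K : ℕ)) = ((p - 1 : ℕ) : ℤ) by push_cast; omega,
        zpow_natCast]
    have e2 : (2 : ℚ) ^ j * (2 : ℚ) ^ s = 2 ^ (p - 1) / 2 ^ K := by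
      rw [eq_div_iff (by positivity), ← e1]; ring
    rw [hn_def, add_mul, e1, e2]
  -- scale q = m/n into [1/2, 1)
  set q : ℚ := (m : ℚ) / n with hq_def
  have hq0 : 0 < q := by positivity
  set L : ℤ := Int.log 2 q with hL
  set c : ℤ := -L - 1 with hc
  have hq'1 : 1 / 2 ≤ q * 2 ^ c := by
    have := Int.zpow_log_le_self (b := 2) (by norm_num) hq0
    rw [← hL] at this
    have e : (2 : ℚ) ^ L * 2 ^ c = 1 / 2 := by
      rw [← zpow_add₀ h2, hc, show L + (-L - 1) = -1 by ring]; norm_num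
    calc (1 : ℚ) / 2 = 2 ^ L * 2 ^ c := e.symm
      _ ≤ q * 2 ^ c := mul_le_mul_of_nonneg_right this (zpow_pos (by norm_num) c).le
  have hq'2 : q * 2 ^ c < 1 := by
    have := Int.lt_zpow_succ_log_self (b := 2) (by norm_num) q
    rw [← hL] at this
    have e : (2 : ℚ) ^ (L + 1) * 2 ^ c = 1 := by
      rw [← zpow_add₀ h2, hc, show L + 1 + (-L - 1) = 0 by ring, zpow_zero]
    calc q * 2 ^ c < 2 ^ (L + 1) * 2 ^ c := mul_lt_mul_of_pos_right this (zpow_pos (by norm_num) c)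
      _ = 1 := e
  -- the scaled m is an integer m' = m · 2^(c+s) with c + s ≥ 0
  have hNn1 : (2 : ℚ) ^ (p - 1) < Nn := by
    rw [hNn_def]; linarith [(by positivity : (0 : ℚ) < 2 ^ (p - 1) / 2 ^ K)]
  have hNn2 : Nn < 2 ^ p := by
    have hK2 : (2 : ℚ) ≤ 2 ^ K := by
      calc (2 : ℚ) = 2 ^ 1 := by norm_num
        _ ≤ 2 ^ K := pow_le_pow_right₀ (by norm_num) hK
    have h3 : (2 : ℚ) ^ (p - 1) / 2 ^ K ≤ 2 ^ (p - 1) / 2 :=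
      div_le_div_of_nonneg_left (by positivity) (by norm_num) hK2
    have hp2 : (2 : ℚ) ^ p = 2 ^ (p - 1) * 2 := by
      rw [← pow_succ, Nat.sub_add_cancel hp1]
    rw [hNn_def, hp2]; linarith
  have hm's : (m : ℚ) * 2 ^ (c + s) = q * 2 ^ c * Nn := by
    rw [← hns, hq_def, zpow_add₀ h2]; field_simp
  have hcs : 0 ≤ c + s := by
    by_contra hneg
    push Not at hneg
    have h1 : (2 : ℚ) ^ (c + s) ≤ 1 / 2 := by
      calc (2 : ℚ) ^ (c + s) ≤ 2 ^ (-1 : ℤ) := zpow_le_zpow_right₀ (by norm_num) (by omega)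
        _ = 1 / 2 := by norm_num
    have hmZ : (m : ℚ) ≤ 2 ^ (p - 1) - 1 := by
      have : m ≤ 2 ^ (p - 1) - 1 := by
        have : (m : ℚ) < ((2 ^ (p - 1) : ℤ) : ℚ) := by push_cast; exact hm
        have := Int.cast_lt.mp this; omega
      exact_mod_cast this
    have hp3 : (2 : ℚ) ^ (p - 1) = 2 ^ (p - 2) * 2 := by
      rw [← pow_succ]; congr 1; omega
    -- m·2^(c+s) ≤ (2^(p-1) - 1)/2 < 2^(p-2) < Nn/2 ≤ q 2^c Nn
    have h4 : (m : ℚ) * 2 ^ (c + s) ≤ (2 ^ (p - 1) - 1) * (1 / 2) :=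
      mul_le_mul hmZ h1 (zpow_pos (by norm_num) _).le (by linarith [(one_le_pow₀ (by norm_num : (1 : ℚ) ≤ 2) : (1 : ℚ) ≤ 2 ^ (p - 1))])
    have h5 : Nn * (1 / 2) ≤ q * 2 ^ c * Nn := by nlinarith
    rw [← hm's] at h5
    nlinarith
  obtain ⟨u, hu⟩ : ∃ u : ℕ, c + s = u := ⟨(c + s).toNat, (Int.toNat_of_nonneg hcs).symm⟩
  set m' : ℤ := m * 2 ^ u with hm'_def
  have hm'q : (m' : ℚ) = q * 2 ^ c * Nn := by
    rw [← hm's, hu, zpow_natCast, hm'_def]; push_cast; ring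
  -- hypotheses of the normalised core
  have hlo : Nn ≤ 2 * m' := by rw [hm'q]; nlinarith
  have hhi : (m' : ℚ) < Nn := by rw [hm'q]; nlinarith
  have hm'1 : (2 : ℚ) ^ (p - 2) < m' := by
    have hp3 : (2 : ℚ) ^ (p - 1) = 2 ^ (p - 2) * 2 := by
      rw [← pow_succ]; congr 1; omega
    nlinarith
  have hm'2 : (m' : ℚ) < 2 ^ p := lt_trans hhi hNn2
  have hq' : IsNearestU p ((m' : ℚ) / Nn) (qb * 2 ^ c) := by
    have := hq.mul_two_zpow c
    rw [hm'q, mul_div_assoc, div_self hNn0.ne', mul_one]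
    exact this
  have hbound := goldberg_bound hp hK hlo hhi hq'
  -- t' = Nn · (qb 2^c) = (n qb) · 2^(c+s)
  have ht' : Nn * (qb * 2 ^ c) = n * qb * 2 ^ (c + s) := by
    rw [← hns, zpow_add₀ h2]; ring
  rw [ht'] at hbound
  have hm'c : (m' : ℚ) = (m : ℚ) * 2 ^ (c + s) := by rw [hm'_def, hu, zpow_natCast]; push_cast; ring
  rw [hm'c] at hbound hm'1 hm'2
  have hnear := isNearestU_of_abs_sub_le_quarter hp (m := m') (by rwa [hm'c]) (by rwa [hm'c])
    (t := n * qb * 2 ^ (c + s)) (by rwa [hm'c])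
  refine ⟨?_, fun y hy hne => ?_⟩
  · have h := hnear.mul_two_zpow (-(c + s))
    have e1 : n * qb * 2 ^ (c + s) * 2 ^ (-(c + s)) = n * qb := by
      rw [mul_assoc, ← zpow_add₀ h2, add_neg_cancel, zpow_zero, mul_one]
    have e2 : (m' : ℚ) * 2 ^ (-(c + s)) = m := by
      rw [hm'c, mul_assoc, ← zpow_add₀ h2, add_neg_cancel, zpow_zero, mul_one]
    rw [e1, e2] at h
    exact h
  · have hy' := hy.mul_two_zpow (c + s)
    have hne' : y * 2 ^ (c + s) ≠ (m' : ℚ) := by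
      rw [hm'c]; intro h; apply hne
      have h2cs : (2 : ℚ) ^ (c + s) ≠ 0 := (zpow_pos (by norm_num) _).ne'
      exact mul_right_cancel₀ h2cs h
    have := not_evenSignificand_of_tie hp (m := m') (by rwa [hm'c]) (by rwa [hm'c])
      (t := n * qb * 2 ^ (c + s)) (by rwa [hm'c]) hy' hne'
    rwa [evenSignificand_mul_two_zpow_iff] at this

/-- Theorem 7 in "nearest point" form, all cases: `|m| < 2^(p-1)`, `n = 2^i + 2^j`, `q̄` ANY nearest
float of `m/n`; then `m` is a nearest float of `n·q̄`, and every other nearest float of `n·q̄` has an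
odd normalised significand.
[cite: Goldberg1991, Theorem 7 (reprint p. 168)] -/
theorem nearest_mul_roundedQuotient (hp : 2 ≤ p) {m : ℤ} (hm : |m| < 2 ^ (p - 1)) (i j : ℕ)
    {qb : ℚ} (hq : IsNearestU p ((m : ℚ) / (2 ^ i + 2 ^ j)) qb) :
    IsNearestU p ((2 ^ i + 2 ^ j : ℚ) * qb) m ∧
      ∀ y : ℚ, IsNearestU p ((2 ^ i + 2 ^ j : ℚ) * qb) y → y ≠ m → ¬ EvenSignificand p y := by
  have hp1 : 1 ≤ p := by omega
  -- positive m, any i ≠ j or i = j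
  have pos : ∀ {m : ℤ}, 0 < m → (m : ℚ) < 2 ^ (p - 1) → ∀ {qb : ℚ},
      IsNearestU p ((m : ℚ) / (2 ^ i + 2 ^ j)) qb →
      IsNearestU p ((2 ^ i + 2 ^ j : ℚ) * qb) m ∧
        ∀ y : ℚ, IsNearestU p ((2 ^ i + 2 ^ j : ℚ) * qb) y → y ≠ m → ¬ EvenSignificand p y := by
    intro m hm0 hm qb hq
    rcases lt_trichotomy j i with hji | hji | hji
    · exact nearest_of_pos_of_lt hp hm0 hm hji hq
    · -- i = j: n = 2^(i+1), the quotient is exact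
      subst hji
      have hmf' : IsFloatU p ((m : ℚ) / (2 ^ j + 2 ^ j)) := by
        have hmabs : |m| < 2 ^ p := by
          have : (m : ℚ) < 2 ^ p := lt_of_lt_of_le hm (pow_le_pow_right₀ (by norm_num) (by omega))
          rw [abs_of_pos hm0]; exact_mod_cast this
        have := isFloatU_int_mul_zpow (p := p) hmabs (-((j : ℤ) + 1))
        rw [zpow_neg, show ((j : ℤ) + 1) = ((j + 1 : ℕ) : ℤ) by push_cast; ring, zpow_natCast,
          pow_succ, ← div_eq_mul_inv] at this
        rwa [← two_mul, mul_comm]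
      have hqb : qb = (m : ℚ) / (2 ^ j + 2 ^ j) := hq.eq_of_isFloatU hmf'
      have ht : (2 ^ j + 2 ^ j : ℚ) * qb = m := by
        rw [hqb]; field_simp
      rw [ht]
      have hmf : IsFloatU p (m : ℚ) := by
        refine isFloatU_int ?_
        have : (m : ℚ) < 2 ^ p := lt_of_lt_of_le hm (pow_le_pow_right₀ (by norm_num) (by omega))
        rw [abs_of_pos hm0]; exact_mod_cast this
      refine ⟨⟨hmf, fun f _ => by simp⟩, fun y hy hne => absurd (hy.eq_of_isFloatU hmf) hne⟩
    · have := nearest_of_pos_of_lt hp hm0 hm hji (qb := qb) (by rwa [add_comm])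
      rwa [add_comm (2 ^ j : ℚ)] at this
  rcases lt_trichotomy 0 m with hm0 | hm0 | hm0
  · exact pos hm0 (by rw [abs_of_pos hm0] at hm; exact_mod_cast hm) hq
  · -- m = 0
    subst hm0
    have h0 : IsFloatU p (0 : ℚ) := isFloatU_int (by simp)
    have hqb : qb = 0 := by
      have := hq.eq_of_isFloatU (by push_cast; rw [zero_div]; exact h0)
      rw [this]; push_cast; rw [zero_div]
    subst hqb
    refine ⟨⟨by exact_mod_cast h0, fun f _ => by simp⟩, fun y hy hne => ?_⟩
    exact absurd (hy.eq_of_isFloatU (by rw [mul_zero]; exact h0)) (by push_cast at hne; rwa [mul_zero])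
  · -- m < 0: apply the positive case to -m and -qb
    have hm' : ((-m : ℤ) : ℚ) < 2 ^ (p - 1) := by
      rw [abs_of_neg hm0] at hm; exact_mod_cast hm
    have hq' : IsNearestU p (((-m : ℤ) : ℚ) / (2 ^ i + 2 ^ j)) (-qb) := by
      have := hq.neg; push_cast; rwa [neg_div]
    obtain ⟨h1, h2⟩ := pos (by omega) hm' hq'
    refine ⟨?_, fun y hy hne => ?_⟩
    · have := h1.neg; push_cast at this; simpa using this
    · have hy' : IsNearestU p ((2 ^ i + 2 ^ j : ℚ) * -qb) (-y) := by
        have := hy.neg; simpa using this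
      have := h2 (-y) hy' (by push_cast; exact fun h => hne (neg_injective h))
      rwa [evenSignificand_neg_iff] at this

/-- **Theorem 7 (Goldberg 1991 / Kahan).** Radix 2, precision `p ≥ 2`, exactly rounded operations
(`fl` a round-to-nearest division — any tie rule —, `fl'` the round-to-nearest-ties-to-even
multiplication): for integers `|m| < 2^(p-1)` and `n = 2^i + 2^j`, `(m ⊘ n) ⊗ n = m`.
[cite: Goldberg1991, Theorem 7 (reprint p. 168)] -/
theorem div_mul_eq_self (hp : 2 ≤ p) {fl fl' : ℚ → ℚ} (hfl : IsRoundNearestU p fl)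
    (hfl' : IsRoundNearestEvenU p fl') {m : ℤ} (hm : |m| < 2 ^ (p - 1)) (i j : ℕ) :
    fl' ((2 ^ i + 2 ^ j : ℚ) * fl (m / (2 ^ i + 2 ^ j))) = m := by
  obtain ⟨hnear, htie⟩ := nearest_mul_roundedQuotient hp hm i j (isNearestU_apply hfl _)
  set t : ℚ := (2 ^ i + 2 ^ j : ℚ) * fl (m / (2 ^ i + 2 ^ j))
  by_contra hne
  have hy : IsNearestU p t (fl' t) := isNearestU_apply hfl'.1 t
  have heq : |t - m| = |t - fl' t| := le_antisymm (hnear.2 _ hy.1) (hy.2 _ hnear.1)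
  exact htie _ hy hne (hfl'.2 t m hnear.1 (Ne.symm hne) heq)

/-- With a round-to-nearest multiplication under ANY tie rule the product is still `m` unless `n·q̄`
is a midpoint, in which case it is `m` or the odd neighbour: `m` is always a nearest float of
`n ⊗̂ (m ⊘ n)`'s exact value. [cite: Goldberg1991, Theorem 7 (reprint p. 168)] -/
theorem isNearestU_int_of_div_mul (hp : 2 ≤ p) {fl : ℚ → ℚ} (hfl : IsRoundNearestU p fl)
    {m : ℤ} (hm : |m| < 2 ^ (p - 1)) (i j : ℕ) :
    IsNearestU p ((2 ^ i + 2 ^ j : ℚ) * fl (m / (2 ^ i + 2 ^ j))) m :=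
  (nearest_mul_roundedQuotient hp hm i j (isNearestU_apply hfl _)).1

/-- "Dividing `m` by 10 … multiplying `m/10` by 10 will miraculously restore `m`": `10 = 2^3 + 2^1`.
[cite: Goldberg1991, §"Exactly Rounded Operations" (reprint p. 168)] -/
theorem div_ten_mul_ten_eq_self (hp : 2 ≤ p) {fl fl' : ℚ → ℚ} (hfl : IsRoundNearestU p fl)
    (hfl' : IsRoundNearestEvenU p fl') {m : ℤ} (hm : |m| < 2 ^ (p - 1)) :
    fl' (10 * fl (m / 10)) = m := by
  have := div_mul_eq_self hp hfl hfl' hm 3 1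
  norm_num at this
  exact this

/-- The binary64 instance (`p = 53`): `(m ⊘ 10) ⊗ 10 = m` for every integer `|m| < 2^52`, e.g.
"`(3.0/10.0)*10.0` evaluates to `3`" (reprint p. 192).
[cite: Goldberg1991, Theorem 7 (reprint p. 168); §"Languages and Compilers" (reprint p. 192)] -/
theorem binary64_div_ten_mul_ten {fl fl' : ℚ → ℚ} (hfl : IsRoundNearestU 53 fl)
    (hfl' : IsRoundNearestEvenU 53 fl') {m : ℤ} (hm : |m| < 2 ^ 52) :
    fl' (10 * fl (m / 10)) = m :=
  div_ten_mul_ten_eq_self (by norm_num) hfl hfl' (by norm_num; exact hm)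


/-! ### Sharpness, decided on explicit values (`p = 4`) -/

/-- A float with quantum exponent `e ≥ -k` is an integer multiple of `2^(-k)`. [folklore] -/
private theorem exists_int_mul_of_le_exp {M e : ℤ} {k : ℕ} (he : -(k : ℤ) ≤ e) :
    ∃ Y : ℤ, (M : ℚ) * 2 ^ e * 2 ^ k = Y := by
  refine ⟨M * 2 ^ (e + k).toNat, ?_⟩
  push_cast
  rw [← zpow_natCast (2 : ℚ) ((e + k).toNat), Int.toNat_of_nonneg (by omega),
    zpow_add₀ (by norm_num : (2 : ℚ) ≠ 0), zpow_natCast]; ring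

/-- A float with quantum exponent `e < -k` is small: `|M·2^e| ≤ (2^p - 1)/2^(k+1)`.
[folklore] -/
private theorem abs_le_of_exp_lt {M e : ℤ} (hM : |M| < 2 ^ p) {k : ℕ} (he : e < -(k : ℤ)) :
    |(M : ℚ) * 2 ^ e| ≤ (2 ^ p - 1) / 2 ^ (k + 1) := by
  have hMq : |(M : ℚ)| ≤ 2 ^ p - 1 := by
    have : |M| ≤ 2 ^ p - 1 := by omega
    exact_mod_cast this
  have h2e : (2 : ℚ) ^ e ≤ 1 / 2 ^ (k + 1) := by
    calc (2 : ℚ) ^ e ≤ 2 ^ (-((k : ℤ) + 1)) := zpow_le_zpow_right₀ (by norm_num) (by omega)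
      _ = 1 / 2 ^ (k + 1) := by
        rw [zpow_neg, show ((k : ℤ) + 1) = ((k + 1 : ℕ) : ℤ) by push_cast; ring, zpow_natCast,
          one_div]
  rw [abs_mul, abs_of_pos (zpow_pos (by norm_num : (0 : ℚ) < 2) e), div_eq_mul_one_div]
  exact mul_le_mul hMq h2e (zpow_pos (by norm_num : (0 : ℚ) < 2) e).le
    (by linarith [abs_nonneg (M : ℚ)])

/-- **The halfway case of Theorem 7 occurs** (`p = 4`, `m = 3`, `n = 5 = 2^2 + 2^0`): every
round-to-nearest division gives `3 ⊘ 5 = 5/8` (the unique nearest float of `3/5`), and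
`5 · (5/8) = 25/8` is the MIDPOINT of the consecutive floats `3` and `13/4`; `|13/4| > |3|`, so
round-half-AWAY multiplication returns `13/4 ≠ 3` — the even tie rule ("its low-order bit was 0") is
what the printed proof uses and what the theorem needs.
[cite: Goldberg1991, Theorem 7, proof (reprint p. 169) "To deal with the halfway case"] -/
theorem tie_example {fl : ℚ → ℚ} (hfl : IsRoundNearestU 4 fl) :
    fl (3 / 5) = 5 / 8 ∧ (5 : ℚ) * (5 / 8) = 25 / 8 ∧
      IsFloatU 4 (3 : ℚ) ∧ IsFloatU 4 ((13 : ℚ) / 4) ∧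
      |(25 : ℚ) / 8 - 3| = |(25 : ℚ) / 8 - 13 / 4| ∧ |(3 : ℚ)| < |(13 : ℚ) / 4| := by
  refine ⟨?_, by norm_num, isFloatU_int (by norm_num), ?_, by norm_num, by norm_num⟩
  · obtain ⟨⟨M, e, hM, hy⟩, hmin⟩ := hfl (3 / 5)
    have h58 : IsFloatU 4 ((5 : ℚ) / 8) := ⟨5, -3, by norm_num, by norm_num⟩
    have hle := hmin _ h58
    have h140 : |(3 : ℚ) / 5 - 5 / 8| = 1 / 40 := by
      rw [abs_of_nonpos (by norm_num)]; norm_num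
    rw [hy, h140] at hle
    rw [hy]
    norm_num at hM
    rcases le_or_gt (-(4 : ℕ) : ℤ) e with he | he
    · obtain ⟨Y, hY⟩ := exists_int_mul_of_le_exp (M := M) he
      have hYq : (M : ℚ) * 2 ^ e = Y / 16 := by rw [← hY]; norm_num
      rw [hYq] at hle ⊢
      have hY10 : Y = 10 := by
        by_contra hne
        rcases le_or_gt Y 9 with h | h
        · have : (Y : ℚ) ≤ 9 := by exact_mod_cast h
          rw [abs_of_nonneg (by linarith : (0 : ℚ) ≤ 3 / 5 - Y / 16)] at hle
          linarith
        · have h11 : 11 ≤ Y := by omega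
          have : (11 : ℚ) ≤ Y := by exact_mod_cast h11
          rw [abs_of_nonpos (by linarith : (3 : ℚ) / 5 - Y / 16 ≤ 0)] at hle
          linarith
      rw [hY10]; norm_num
    · have hsmall : |(M : ℚ) * 2 ^ e| ≤ (2 ^ 4 - 1) / 2 ^ (4 + 1) :=
        abs_le_of_exp_lt (p := 4) (by norm_num; exact hM) (k := 4) he
      have := (abs_le.mp hsmall).2
      norm_num at this
      rw [abs_of_nonneg (by linarith : (0 : ℚ) ≤ 3 / 5 - M * 2 ^ e)] at hle
      linarith
  · exact ⟨13, -2, by norm_num, by norm_num⟩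


/-- `13` is not of the special form `2^i + 2^j` (the hypothesis of Theorem 7 that `thirteen_fails`
shows to be needed). [cite: Goldberg1991, Theorem 7 (reprint p. 168)] -/
theorem two_pow_add_two_pow_ne_thirteen (i j : ℕ) : (2 : ℕ) ^ i + 2 ^ j ≠ 13 := by
  intro h
  have h2i := Nat.two_pow_pos i
  have h2j := Nat.two_pow_pos j
  have hi : i < 4 := by
    by_contra hi
    push Not at hi
    have : 16 ≤ 2 ^ i :=
      calc (16 : ℕ) = 2 ^ 4 := by norm_num
        _ ≤ 2 ^ i := Nat.pow_le_pow_right (by norm_num) hi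
    omega
  have hj : j < 4 := by
    by_contra hj
    push Not at hj
    have : 16 ≤ 2 ^ j :=
      calc (16 : ℕ) = 2 ^ 4 := by norm_num
        _ ≤ 2 ^ j := Nat.pow_le_pow_right (by norm_num) hj
    omega
  have key : ∀ a < 4, ∀ b < 4, (2 : ℕ) ^ a + 2 ^ b ≠ 13 := by decide
  exact key i hi j hj h

/-- **The hypothesis `n = 2^i + 2^j` is needed** (`p = 4`, `m = 7 < 2^3`, `n = 13`): every
round-to-nearest division gives `7 ⊘ 13 = 9/16`, and `13 · (9/16) = 117/16` has the UNIQUE nearest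
float `15/2`, so `(7 ⊘ 13) ⊗ 13 = 15/2 ≠ 7` whatever the tie rules.
[cite: Goldberg1991, Theorem 7 (reprint p. 168) "n has the special form n = 2^i + 2^j"] -/
theorem thirteen_fails {fl fl' : ℚ → ℚ} (hfl : IsRoundNearestU 4 fl) (hfl' : IsRoundNearestU 4 fl') :
    fl (7 / 13) = 9 / 16 ∧ fl' (13 * fl (7 / 13)) = 15 / 2 ∧ (15 / 2 : ℚ) ≠ 7 := by
  have h1 : fl (7 / 13) = 9 / 16 := by
    obtain ⟨⟨M, e, hM, hy⟩, hmin⟩ := hfl (7 / 13)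
    have hx : IsFloatU 4 ((9 : ℚ) / 16) := ⟨9, -4, by norm_num, by norm_num⟩
    have hle := hmin _ hx
    have hd : |(7 : ℚ) / 13 - 9 / 16| = 5 / 208 := by
      rw [abs_of_nonpos (by norm_num)]; norm_num
    rw [hy, hd] at hle
    rw [hy]
    norm_num at hM
    rcases le_or_gt (-(4 : ℕ) : ℤ) e with he | he
    · obtain ⟨Y, hY⟩ := exists_int_mul_of_le_exp (M := M) he
      have hYq : (M : ℚ) * 2 ^ e = Y / 16 := by rw [← hY]; norm_num
      rw [hYq] at hle ⊢
      have hY9 : Y = 9 := by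
        by_contra hne
        rcases le_or_gt Y 8 with h | h
        · have : (Y : ℚ) ≤ 8 := by exact_mod_cast h
          rw [abs_of_nonneg (by linarith : (0 : ℚ) ≤ 7 / 13 - Y / 16)] at hle
          linarith
        · have h10 : 10 ≤ Y := by omega
          have : (10 : ℚ) ≤ Y := by exact_mod_cast h10
          rw [abs_of_nonpos (by linarith : (7 : ℚ) / 13 - Y / 16 ≤ 0)] at hle
          linarith
      rw [hY9]; norm_num
    · have hsmall : |(M : ℚ) * 2 ^ e| ≤ (2 ^ 4 - 1) / 2 ^ (4 + 1) :=
        abs_le_of_exp_lt (p := 4) (by norm_num; exact hM) (k := 4) he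
      have := (abs_le.mp hsmall).2
      norm_num at this
      rw [abs_of_nonneg (by linarith : (0 : ℚ) ≤ 7 / 13 - M * 2 ^ e)] at hle
      linarith
  have h2 : fl' (117 / 16) = 15 / 2 := by
    obtain ⟨⟨M, e, hM, hy⟩, hmin⟩ := hfl' (117 / 16)
    have hx : IsFloatU 4 ((15 : ℚ) / 2) := ⟨15, -1, by norm_num, by norm_num⟩
    have hle := hmin _ hx
    have hd : |(117 : ℚ) / 16 - 15 / 2| = 3 / 16 := by
      rw [abs_of_nonpos (by norm_num)]; norm_num
    rw [hy, hd] at hle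
    rw [hy]
    norm_num at hM
    rcases le_or_gt (-(1 : ℕ) : ℤ) e with he | he
    · obtain ⟨Y, hY⟩ := exists_int_mul_of_le_exp (M := M) he
      have hYq : (M : ℚ) * 2 ^ e = Y / 2 := by rw [← hY]; norm_num
      rw [hYq] at hle ⊢
      have hY15 : Y = 15 := by
        by_contra hne
        rcases le_or_gt Y 14 with h | h
        · have : (Y : ℚ) ≤ 14 := by exact_mod_cast h
          rw [abs_of_nonneg (by linarith : (0 : ℚ) ≤ 117 / 16 - Y / 2)] at hle
          linarith
        · have h16 : 16 ≤ Y := by omega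
          have : (16 : ℚ) ≤ Y := by exact_mod_cast h16
          rw [abs_of_nonpos (by linarith : (117 : ℚ) / 16 - Y / 2 ≤ 0)] at hle
          linarith
      rw [hY15]; norm_num
    · have hsmall : |(M : ℚ) * 2 ^ e| ≤ (2 ^ 4 - 1) / 2 ^ (1 + 1) :=
        abs_le_of_exp_lt (p := 4) (by norm_num; exact hM) (k := 1) he
      have := (abs_le.mp hsmall).2
      norm_num at this
      rw [abs_of_nonneg (by linarith : (0 : ℚ) ≤ 117 / 16 - M * 2 ^ e)] at hle
      linarith
  refine ⟨h1, ?_, by norm_num⟩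
  rw [h1]; norm_num; exact h2

/-- `13 = 13·2^0` has an odd normalised significand: no representation `M·2^e` with
`2^3 ≤ |M| < 2^4` and `M` even (used by `large_m_fails`).
[cite: Goldberg1991, Theorem 7, proof (reprint p. 169) "its low-order bit was 0"] -/
theorem not_evenSignificand_thirteen : ¬ EvenSignificand 4 (13 : ℚ) := by
  rintro ⟨M, e, hM1, hM2, ⟨r, hr⟩, h13⟩
  norm_num at hM1 hM2
  rcases lt_trichotomy e 0 with he | he | he
  · -- e ≤ -1: |M| = 13 · 2^(-e) ≥ 26
    have h2e : (2 : ℚ) ^ e ≤ 1 / 2 := by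
      calc (2 : ℚ) ^ e ≤ 2 ^ (-1 : ℤ) := zpow_le_zpow_right₀ (by norm_num) (by omega)
        _ = 1 / 2 := by norm_num
    have hMq : |(M : ℚ)| ≤ 15 := by
      have : |M| ≤ 15 := by omega
      exact_mod_cast this
    have : (13 : ℚ) ≤ 15 * (1 / 2) := by
      calc (13 : ℚ) = |(13 : ℚ)| := by norm_num
        _ = |(M : ℚ)| * 2 ^ e := by
          rw [h13, abs_mul, abs_of_pos (zpow_pos (by norm_num : (0 : ℚ) < 2) e)]
        _ ≤ 15 * (1 / 2) :=
          mul_le_mul hMq h2e (zpow_pos (by norm_num : (0 : ℚ) < 2) e).le (by norm_num)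
    norm_num at this
  · subst he
    simp only [zpow_zero, mul_one] at h13
    have hM13 : M = 13 := by exact_mod_cast h13.symm
    omega
  · -- e ≥ 1: 13 = M·2^e is even
    obtain ⟨k, hk⟩ : ∃ k : ℕ, e = (k : ℤ) + 1 := ⟨(e - 1).toNat, by omega⟩
    subst hk
    have : (13 : ℚ) = 2 * ((M : ℚ) * 2 ^ (k : ℤ)) := by
      rw [h13, zpow_add₀ (by norm_num : (2 : ℚ) ≠ 0), zpow_one]; ring
    rw [zpow_natCast] at this
    have h' : (13 : ℤ) = 2 * (M * 2 ^ k) := by exact_mod_cast this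
    omega

/-- **The hypothesis `|m| < 2^(p-1)` is needed** (`p = 4`, `m = 13 ≥ 2^3`, `n = 3 = 2^1 + 2^0`):
every round-to-nearest division gives `13 ⊘ 3 = 9/2`, and `3 · (9/2) = 27/2` is the midpoint of the
floats `13` and `14`; ties-to-even multiplication returns `14 ≠ 13`.
[cite: Goldberg1991, Theorem 7 (reprint p. 168) "|m| < 2^(p-1)"] -/
theorem large_m_fails {fl fl' : ℚ → ℚ} (hfl : IsRoundNearestU 4 fl)
    (hfl' : IsRoundNearestEvenU 4 fl') :
    fl (13 / 3) = 9 / 2 ∧ fl' (3 * fl (13 / 3)) = 14 ∧ (14 : ℚ) ≠ 13 := by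
  have h1 : fl (13 / 3) = 9 / 2 := by
    obtain ⟨⟨M, e, hM, hy⟩, hmin⟩ := hfl (13 / 3)
    have hx : IsFloatU 4 ((9 : ℚ) / 2) := ⟨9, -1, by norm_num, by norm_num⟩
    have hle := hmin _ hx
    have hd : |(13 : ℚ) / 3 - 9 / 2| = 1 / 6 := by
      rw [abs_of_nonpos (by norm_num)]; norm_num
    rw [hy, hd] at hle
    rw [hy]
    norm_num at hM
    rcases le_or_gt (-(1 : ℕ) : ℤ) e with he | he
    · obtain ⟨Y, hY⟩ := exists_int_mul_of_le_exp (M := M) he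
      have hYq : (M : ℚ) * 2 ^ e = Y / 2 := by rw [← hY]; norm_num
      rw [hYq] at hle ⊢
      have hY9 : Y = 9 := by
        by_contra hne
        rcases le_or_gt Y 8 with h | h
        · have : (Y : ℚ) ≤ 8 := by exact_mod_cast h
          rw [abs_of_nonneg (by linarith : (0 : ℚ) ≤ 13 / 3 - Y / 2)] at hle
          linarith
        · have h10 : 10 ≤ Y := by omega
          have : (10 : ℚ) ≤ Y := by exact_mod_cast h10
          rw [abs_of_nonpos (by linarith : (13 : ℚ) / 3 - Y / 2 ≤ 0)] at hle
          linarith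
      rw [hY9]; norm_num
    · have hsmall : |(M : ℚ) * 2 ^ e| ≤ (2 ^ 4 - 1) / 2 ^ (1 + 1) :=
        abs_le_of_exp_lt (p := 4) (by norm_num; exact hM) (k := 1) he
      have := (abs_le.mp hsmall).2
      norm_num at this
      rw [abs_of_nonneg (by linarith : (0 : ℚ) ≤ 13 / 3 - M * 2 ^ e)] at hle
      linarith
  have h2 : fl' (27 / 2) = 14 := by
    obtain ⟨⟨M, e, hM, hy⟩, hmin⟩ := hfl'.1 (27 / 2)
    have h14 : IsFloatU 4 (14 : ℚ) := isFloatU_int (by norm_num)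
    have h13 : IsFloatU 4 (13 : ℚ) := isFloatU_int (by norm_num)
    have hle := hmin _ h14
    have hd : |(27 : ℚ) / 2 - 14| = 1 / 2 := by
      rw [abs_of_nonpos (by norm_num)]; norm_num
    rw [hd] at hle
    norm_num at hM
    rcases le_or_gt (-(0 : ℕ) : ℤ) e with he | he
    · obtain ⟨Y, hY⟩ := exists_int_mul_of_le_exp (M := M) he
      have hYq : (M : ℚ) * 2 ^ e = Y := by rw [← hY]; norm_num
      rw [hy, hYq] at hle
      have hY : Y = 13 ∨ Y = 14 := by
        by_contra hne
        push Not at hne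
        rcases le_or_gt Y 12 with h | h
        · have : (Y : ℚ) ≤ 12 := by exact_mod_cast h
          rw [abs_of_nonneg (by linarith : (0 : ℚ) ≤ 27 / 2 - Y)] at hle
          linarith
        · have h15 : 15 ≤ Y := by omega
          have : (15 : ℚ) ≤ Y := by exact_mod_cast h15
          rw [abs_of_nonpos (by linarith : (27 : ℚ) / 2 - Y ≤ 0)] at hle
          linarith
      rcases hY with hY | hY
      · -- the tie partner 13 is refused by the even rule
        exfalso
        have hval : fl' (27 / 2) = 13 := by rw [hy, hYq, hY]; norm_num
        have htie := hfl'.2 (27 / 2) 14 h14 (by rw [hval]; norm_num)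
          (by rw [hval, abs_of_nonpos (by norm_num), abs_of_nonneg (by norm_num)]; norm_num)
        rw [hval] at htie
        exact not_evenSignificand_thirteen htie
      · rw [hy, hYq, hY]; norm_num
    · have hsmall : |(M : ℚ) * 2 ^ e| ≤ (2 ^ 4 - 1) / 2 ^ (0 + 1) :=
        abs_le_of_exp_lt (p := 4) (by norm_num; exact hM) (k := 0) he
      have := (abs_le.mp hsmall).2
      norm_num at this
      rw [hy, abs_of_nonneg (by linarith : (0 : ℚ) ≤ 27 / 2 - M * 2 ^ e)] at hle
      linarith
  refine ⟨h1, ?_, by norm_num⟩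
  rw [h1]; norm_num; exact h2

end Literature.ComputerArithmetic.Goldberg1991
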